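import Summits.HodgeConjecture.CorCM.MumfordTateRankTypeIVThreefoldPairsExact
import HarnessLib

/-!
# Two simple abelian THREEFOLDS: `t(T × T′) ∈ {4, …, 7} ∪ {10, …, 13} ∪ {18, 19, 22, 25, 31, 43}` — the partition {3,3} of a non-simple sixfold,
# sharpened by the exact type-IV × type-IV cell

COR-CM (cell `pub-hodgecm2`, seat `b27` gen 52, count-neutral Mumford–Tate-rank ladder; theorems only, no definition, no named fact; UNCONDITIONAL —
nothing here uses or asserts HC_CM).  `t := dim MT(H¹·)`.  Gen 50 (`CorCM/MumfordTateRankSimpleThreefoldPairs`) tabulated `t(T × T′)` for two SIMPLE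
complex abelian threefolds: exact rows `T ∼ T′`, `End⁰T = ℚ` (`t(T′) + 21`), real cubic (`t(T′) + 9`), and the interval `[10, 19]` for two threefolds with
imaginary quadratic multiplication.  With the exact cell of `CorCM/MumfordTateRankTypeIVThreefoldPairsExact` (`t = 10 / 18 / 19` as `T ∼ T′` / `T ≁ T′`
with isomorphic fields / different fields) the values `14, 15, 16, 17` disappear:
* **`mtRank_hodge_one_mem_of_isIsogenous_prod_isSimple_threefolds_sharp`** — `t(T × T′) ∈ {4,5,6,7,10,11,12,13,18,19,22,25,31,43}`.
(The remaining intervals are IV × CM `[10, 13]` and CM × CM `[4, 7]`.)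

## References
* [MoonenZarhin1999LowDim] B. Moonen, Yu. G. Zarhin, *Hodge classes on abelian varieties of low dimension*, Math. Ann. 315 (1999), §2 (2.3), §3 (3.1),
  Lemma (3.4), Prop. (3.8) [corpus: paper:arxiv-math_9901113 pp. 5–7]. [cite: MoonenZarhin1999LowDim, §2 (2.3) and §3 (3.4)]
* [Gordon1999HodgeAVSurvey] B. B. Gordon, *A survey of the Hodge conjecture for abelian varieties*, 7.5–7.7, 9.1. [cite: Gordon1999HodgeAVSurvey, 7.5 and 9.1]
-/

noncomputable section

open CategoryTheory CategoryTheory.Limits Module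

namespace Summit.HodgeConjecture.CorCM

open Literature.AlgebraicGeometry.Motives
open Literature.AlgebraicGeometry.Motives.AbelianVariety
open Literature.AlgebraicGeometry.Motives.HodgeStructure
open Literature.AlgebraicGeometry.HodgeTheory
open Literature.AlgebraicGeometry.Milne1999 (IsOfCMType isOfCMType_iff_of_isIsogenous hom_eq_zero_of_isSimple_of_not_isIsogenous)

variable [HodgeTensorFacts.{0, 0}] {X T T' : AbelianVariety ℂ} {n : ℕ}

/-- **The partition {3,3}, sharp in the type-IV × type-IV cell: `t(T × T′) ∈ {4, …, 7} ∪ {10, …, 13} ∪ {18, 19, 22, 25, 31, 43}` for every pair of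
SIMPLE complex abelian threefolds** (exact in the rows `T ∼ T′`, `End⁰T = ℚ`, `End⁰T` real cubic, IV × IV; intervals for IV × CM and CM × CM).
[cite: MoonenZarhin1999LowDim, §2 (2.3), §3 (3.4) and Prop. (3.8)] [cite: Gordon1999HodgeAVSurvey, 7.5 and 9.1] -/
theorem mtRank_hodge_one_mem_of_isIsogenous_prod_isSimple_threefolds_sharp (hX : IsSmoothProjective n X.X) (hTs : T.IsSimple) (hT3 : T.dim = 3)
    (hT's : T'.IsSimple) (hT'3 : T'.dim = 3) (hXP : IsIsogenous X (T.prod T')) :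
    haveI := BettiUniverse.finite hX 1
    (BettiUniverse.hodge exists_isReal_hodgeModel_holds hX 1).mtRank ∈
      ({4, 5, 6, 7, 10, 11, 12, 13, 18, 19, 22, 25, 31, 43} : Finset ℕ) := by
  classical
  haveI := BettiUniverse.finite hX 1
  have hT : IsSmoothProjective T.dim T.X := AbelianVariety.isSmoothProjective_holds
  have hT' : IsSmoothProjective T'.dim T'.X := AbelianVariety.isSmoothProjective_holds
  haveI := BettiUniverse.finite hT 1
  haveI := BettiUniverse.finite hT' 1
  simp only [Finset.mem_insert, Finset.mem_singleton]
  have hXP' : IsIsogenous X (T'.prod T) := hXP.trans (isIsogenous_prod_comm T T')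
  by_cases hTT' : IsIsogenous T T'
  · have h := mtRank_hodge_one_eq_of_isIsogenous_prod_threefolds_of_isIsogenous hX hT hT3 hTT' hXP
    rcases mtRank_hodge_one_of_isSimple_threefold hT hTs hT3 with ⟨-, h22⟩ | ⟨-, h10⟩ | ⟨-, h10⟩ | ⟨-, -, h4⟩ <;> omega
  have hT'T : ¬ IsIsogenous T' T := fun h => hTT' h.symm'
  rcases AbelianVariety.finrank_endAlgebra_mem_of_isSimple_threefold hTs hT3 with h1 | h2 | h3 | h6
  · rcases mtRank_hodge_one_of_isIsogenous_prod_threefolds_endRankOne hX hT3 h1 hT's hT'3 hTT' hXP with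
      ⟨-, h⟩ | ⟨-, h⟩ | ⟨-, h⟩ | ⟨-, h⟩ <;> omega
  · rcases AbelianVariety.finrank_endAlgebra_mem_of_isSimple_threefold hT's hT'3 with h1' | h2' | h3' | h6'
    · rcases mtRank_hodge_one_of_isIsogenous_prod_threefolds_endRankOne hX hT'3 h1' hTs hT3 hT'T hXP' with
        ⟨-, h⟩ | ⟨-, h⟩ | ⟨-, h⟩ | ⟨-, h⟩ <;> omega
    · rcases mtRank_hodge_one_trichotomy_of_isIsogenous_prod_typeIV_threefolds hX hTs hT3 h2 hT's hT'3 h2' hXP with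
        ⟨-, h⟩ | ⟨-, -, h⟩ | ⟨-, h⟩ <;> omega
    · rcases mtRank_hodge_one_of_isIsogenous_prod_threefolds_cubicEnd hX hT's hT'3 h3' hTs hT3 hT'T hXP' with
        ⟨-, h⟩ | ⟨-, h⟩ | ⟨-, h⟩ | ⟨-, h⟩ <;> omega
    · obtain ⟨hge, hle⟩ := mtRank_hodge_one_mem_Icc_of_isIsogenous_prod_typeIV_cmThreefold hX hTs hT3 h2 hT's hT'3
        (isOfCMType_of_isSimple_threefold_of_finrank_endAlgebra_eq_six hT's hT'3 h6') hXP
      omega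
  · rcases mtRank_hodge_one_of_isIsogenous_prod_threefolds_cubicEnd hX hTs hT3 h3 hT's hT'3 hTT' hXP with
      ⟨-, h⟩ | ⟨-, h⟩ | ⟨-, h⟩ | ⟨-, h⟩ <;> omega
  · have hTcm : IsOfCMType T := isOfCMType_of_isSimple_threefold_of_finrank_endAlgebra_eq_six hTs hT3 h6
    rcases AbelianVariety.finrank_endAlgebra_mem_of_isSimple_threefold hT's hT'3 with h1' | h2' | h3' | h6'
    · rcases mtRank_hodge_one_of_isIsogenous_prod_threefolds_endRankOne hX hT'3 h1' hTs hT3 hT'T hXP' with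
        ⟨-, h⟩ | ⟨-, h⟩ | ⟨-, h⟩ | ⟨-, h⟩ <;> omega
    · obtain ⟨hge, hle⟩ := mtRank_hodge_one_mem_Icc_of_isIsogenous_prod_typeIV_cmThreefold hX hT's hT'3 h2' hTs hT3 hTcm hXP'
      omega
    · rcases mtRank_hodge_one_of_isIsogenous_prod_threefolds_cubicEnd hX hT's hT'3 h3' hTs hT3 hT'T hXP' with
        ⟨-, h⟩ | ⟨-, h⟩ | ⟨-, h⟩ | ⟨-, h⟩ <;> omega
    · obtain ⟨hge, hle⟩ := mtRank_hodge_one_mem_Icc_of_isIsogenous_prod_cmThreefolds hX hTs hT3 hTcm hT's hT'3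
        (isOfCMType_of_isSimple_threefold_of_finrank_endAlgebra_eq_six hT's hT'3 h6') hXP
      omega

end Summit.HodgeConjecture.CorCM

end
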